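import Summits.Ventures.HodgeRepro2.T5SplitPlaceHecke
import Summits.Ventures.HodgeRepro2.T5HeckeCommutativeMultiplicityOne

/-!
# Spherical multiplicity one for `GL_n` over a local field, and the Hecke eigencharacter

Tier-5 kernel support (blind cell pub-hodge-repro2, seat p8, gen 11). T5-75
(`T5HeckeCommutativeMultiplicityOne`) proves, for an irreducible `K`-finite representation `ρ`
with `ρ^K ≠ 0` finite-dimensional over an algebraically closed field of characteristic `0`, that
`dim ρ^K = 1` and that `H(G, K)` acts on the line `ρ^K` through an algebra homomorphism
`H(G, K) →ₐ[k] k` — PROVIDED `H(G, K)` is commutative and every `KgK/K` is finite. Both provisos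
are now kernel facts for `G = GL_n(F)`, `K = GL_n(R)`, `R` a discrete valuation ring with finite
residue field (T5-104, T5-105), and for any `G' ≅ GL_n(F)` carrying `K'` onto `GL_n(R)` (T5-106,
T5-107). This file records the resulting unconditional statements — the «unramified π has a
unique spherical line; its Hecke eigencharacter is the Satake parameter» sentences of the record
(CHECK-N3 §17.1 rows 5–6), with the Satake ISOMORPHISM itself still prose.

* `finrank_invariants_eq_one` — **`dim ρ^K = 1`** for `G = GL ι F`, `K = GL_n(R)`;
* `heckeCharacterAlgHom` — the eigencharacter `H(GL ι F, K) →ₐ[k] k` of such a `ρ`;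
* `finrank_invariants_eq_one_of_equiv`, `heckeCharacterAlgHom_of_equiv` — the same for
  `G' ≅ GL ι F` with `e(K') = GL_n(R)`.

Hypotheses as stated in the kernel: those of T5-105 / T5-107 on `R`, `F`, `ι` (and `e`); `k` an
algebraically closed field of characteristic `0`; `ρ` irreducible (`Representation.IsIrreducible`)
and `K`-finite (`T5LevelIdempotent.KFinite ρ K`) with `ρ^K ≠ ⊥` finite-dimensional
(admissibility at level `K`).
-/

namespace Summit.Ventures.HodgeRepro2.T5SphericalMultiplicityOneGLn

variable {R : Type*} [CommRing R] [IsDomain R] [IsDiscreteValuationRing R]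
  [Finite (IsLocalRing.ResidueField R)]
variable {F : Type*} [Field F] [Algebra R F] [IsFractionRing R F]
variable {ι : Type*} [Fintype ι] [DecidableEq ι]
variable {k : Type*} [Field k] [CharZero k] [IsAlgClosed k]
variable {V : Type*} [AddCommGroup V] [Module k V]

/-- **Spherical multiplicity one for `GL_n(F)`**: an irreducible `K`-finite representation of
`GL ι F` with `ρ^K ≠ 0` finite-dimensional, `K = GL_n(R)`, has `dim ρ^K = 1`. -/
theorem finrank_invariants_eq_one (ρ : Representation k (GL ι F) V) [ρ.IsIrreducible]
    (hK : T5LevelIdempotent.KFinite ρ (Matrix.GeneralLinearGroup.map (n := ι) (algebraMap R F)).range)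
    [FiniteDimensional k (LevelPositivity.invariants ρ
      (Matrix.GeneralLinearGroup.map (n := ι) (algebraMap R F)).range)]
    (hne : LevelPositivity.invariants ρ
      (Matrix.GeneralLinearGroup.map (n := ι) (algebraMap R F)).range ≠ ⊥) :
    Module.finrank k (LevelPositivity.invariants ρ
      (Matrix.GeneralLinearGroup.map (n := ι) (algebraMap R F)).range) = 1 :=
  T5HeckeCommutativeMultiplicityOne.finrank_invariants_eq_one ρ hK
    (fun g => T5CongruenceOrbitFinite.finite_orbit_of_finite_quotients
      (fun c hc => T5DvrFiniteQuotients.finite_quotient_span_singleton c hc) g)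
    hne (T5DvrFiniteQuotients.heckeAlgebra_mul_comm k)

/-- The Hecke eigencharacter of a spherical irreducible representation of `GL ι F`: the algebra
homomorphism `H(GL ι F, GL_n(R)) →ₐ[k] k` through which the Hecke algebra acts on the line `ρ^K`
(the record's Satake parameter, the Satake isomorphism itself staying prose). -/
noncomputable def heckeCharacterAlgHom (ρ : Representation k (GL ι F) V) [ρ.IsIrreducible]
    (hK : T5LevelIdempotent.KFinite ρ (Matrix.GeneralLinearGroup.map (n := ι) (algebraMap R F)).range)
    [FiniteDimensional k (LevelPositivity.invariants ρ
      (Matrix.GeneralLinearGroup.map (n := ι) (algebraMap R F)).range)]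
    (hne : LevelPositivity.invariants ρ
      (Matrix.GeneralLinearGroup.map (n := ι) (algebraMap R F)).range ≠ ⊥) :
    T5HeckePermutationModule.heckeAlgebra k
      (Matrix.GeneralLinearGroup.map (n := ι) (algebraMap R F)).range →ₐ[k] k :=
  T5HeckeCommutativeMultiplicityOne.heckeCharacterAlgHom ρ hK
    (fun g => T5CongruenceOrbitFinite.finite_orbit_of_finite_quotients
      (fun c hc => T5DvrFiniteQuotients.finite_quotient_span_singleton c hc) g)
    hne (T5DvrFiniteQuotients.heckeAlgebra_mul_comm k)

variable {G' : Type*} [Group G'] {K' : Subgroup G'}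

/-- Spherical multiplicity one for any `G' ≅ GL ι F` carrying `K'` onto `GL_n(R)` (the record's
`U(V_v)` at a split place). -/
theorem finrank_invariants_eq_one_of_equiv (e : G' ≃* GL ι F)
    (he : ∀ x, e x ∈ (Matrix.GeneralLinearGroup.map (n := ι) (algebraMap R F)).range ↔ x ∈ K')
    (ρ : Representation k G' V) [ρ.IsIrreducible] (hK : T5LevelIdempotent.KFinite ρ K')
    [FiniteDimensional k (LevelPositivity.invariants ρ K')]
    (hne : LevelPositivity.invariants ρ K' ≠ ⊥) :
    Module.finrank k (LevelPositivity.invariants ρ K') = 1 :=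
  T5HeckeCommutativeMultiplicityOne.finrank_invariants_eq_one ρ hK
    (T5GelfandTransport.finite_orbit_of_equiv e he
      (fun g => T5CongruenceOrbitFinite.finite_orbit_of_finite_quotients
        (fun c hc => T5DvrFiniteQuotients.finite_quotient_span_singleton c hc) g))
    hne (T5SplitPlaceHecke.heckeAlgebra_mul_comm_of_equiv k e he)

/-- The Hecke eigencharacter `H(G', K') →ₐ[k] k` for `G' ≅ GL ι F`, `e(K') = GL_n(R)`. -/
noncomputable def heckeCharacterAlgHom_of_equiv (e : G' ≃* GL ι F)
    (he : ∀ x, e x ∈ (Matrix.GeneralLinearGroup.map (n := ι) (algebraMap R F)).range ↔ x ∈ K')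
    (ρ : Representation k G' V) [ρ.IsIrreducible] (hK : T5LevelIdempotent.KFinite ρ K')
    [FiniteDimensional k (LevelPositivity.invariants ρ K')]
    (hne : LevelPositivity.invariants ρ K' ≠ ⊥) :
    T5HeckePermutationModule.heckeAlgebra k K' →ₐ[k] k :=
  T5HeckeCommutativeMultiplicityOne.heckeCharacterAlgHom ρ hK
    (T5GelfandTransport.finite_orbit_of_equiv e he
      (fun g => T5CongruenceOrbitFinite.finite_orbit_of_finite_quotients
        (fun c hc => T5DvrFiniteQuotients.finite_quotient_span_singleton c hc) g))
    hne (T5SplitPlaceHecke.heckeAlgebra_mul_comm_of_equiv k e he)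

end Summit.Ventures.HodgeRepro2.T5SphericalMultiplicityOneGLn
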